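import Mathlib
import HarnessLib
import HarnessLib.Audit
import Summits.Langlands.Statement
import Literature.NumberTheory.Automorphic.ArithmeticQuotientCohomology
import Literature.NumberTheory.Automorphic.GLnAdelicStructure
import Literature.Barriers.Langlands.TaylorWilesNumericalCoincidence
import Literature.NumberTheory.Automorphic.LocalLanglandsGLProofs
import Literature.NumberTheory.Automorphic.LocalConstantsProofs
import HarnessLib.Audit.Status.Attr

/-!
Route: SplitPrimeInduction

CLOSED (refuted) 2026-08-20T07:33:32Z by gate — reason: refuted:stmt-Langlands-16951 (MonomialSerreAtSplitPrimes) by Summit.Langlands.Langlands.Theorems.SplitPrimeInductionMonomialSerreAtSplitPrimes_refuted — note: repair grace of 72.0 h (deadline 2026-08-20T07:30:51Z) expired without a repair — closed by the gate. The file is kept as the record of this route; refuted decls are indexed as negative knowledge (`ledger negatives`).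

# Route SplitPrimeInduction — split prime makes the twisted Levi a Levi — torsion automorphic
induction along arbitrary F, reciprocity over every field from ℚ

It suffices to show X = LanglandsOverQ ∧ TorsionLeviInduction ∧ MonomialSerreAtSplitPrimes ∧
DeinductionR (the honest remainder of the summit
along this line is the assembly item Assembly, the junction X → Langlands). BARRIER INVERSION
(operator C): assuming ShimuraVarietyRealization(+Narrow), NonRegularWeight(+Narrow)
and SolvableImage(+Narrow), every classical functorial avatar over a TR/CM field of a cuspidal π
over a field F with [F:F⁺] ≥ 3 is maximally singular at ∞
(strong purity; Schur functors never regularise, induction only adds collisions) and no Borel–Serre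
boundary sees X_F (the Levi/boundary trick is exhausted at
quadratic extensions: Out(Dynkin) ≤ S₃, and trialitarian D₄ for a complex cubic is SO(odd,odd)); so
ANY treatment of the field variable must (i) be torsion/p-adic
or archimedean-blind and (ii) use a structure of F/ℚ that exists for every F whatever its Galois
closure. A completely split prime p is that structure: at p the
twisted Levi Res_(F/ℚ)GL_n IS the Levi GL_n^d of GL_(nd)(ℚ_p), local automorphic induction IS
parabolic induction, and the sought transfer lives inside the
Jacquet module of completed cohomology of GL_(nd)/ℚ, where Scholze's Galois determinants exist.
TorsionLeviInduction: for (n even ∨ r₁(F) ≤ 1) every mod-p Hecke eigensystem in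
H^*(X_K, k) for GL_n/F (any level, trivial coefficients = all Serre weights by Ash–Stevens) has its
INDUCED eigensystem (Scholze polynomials
P_ℓ = ∏_(w∣ℓ) P_w(X^f_w)) in H^*(X_K', k) for GL_(n[F:ℚ])/ℚ. MonomialSerreAtSplitPrimes: its n = 1
instance with the Galois side free by class field theory
(Ash 2003's theorem with ℚ(ζ_p) replaced by any F with r₁ ≤ 1 and the Smith prime by a split prime).
DeinductionR: Galois-theoretic extraction of σ̄ over F
from the induced representations of all twists (Taylor/Clifford; rev 9: uniform exceptional set T
for the induced family of all twists, finite exceptional set T′ in the conclusion — the first form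
Deinduction, stmt-Langlands-16822, was refuted-misstated by a junk Frobenius datum at a single place
and is a settled negative, dropped from the route at rev 8; the rev-7 per-twist form was false for n
≥ 2 by a sparse swap adversary). LanglandsOverQ: the archimedean core over ℚ, shared verbatim with
route TwistAveragedDeinduction.
Lean: `LanglandsOverQ ∧ TorsionLeviInduction ∧ MonomialSerreAtSplitPrimes ∧ DeinductionR`

## Assembly
Pure logic (certified in glue.lean): `closes (h₁ : LanglandsOverQ) (h₂ : TorsionLeviInduction) (h₃ :
MonomialSerreAtSplitPrimes) (h₄ : DeinductionR) (hA : Assembly) : Langlands := hA h₂ h₃ h₁ h₄` —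
every crux is a hypothesis; the junction IS the assembly item `Assembly := TorsionLeviInduction →
MonomialSerreAtSplitPrimes → LanglandsOverQ → DeinductionR → Langlands` and its mathematics is the
docstring of Assembly (rev 6, ground repair: the former support item SectorChain was merged into the
assembly item, whose old form L → T → M → D → SectorChain → Langlands was a propositional tautology
flagged ground.trivial).

Rationale: WHY THIS LINE. Mechanism: p-adic/torsion functoriality for a TWISTED LEVI at a prime where it splits
— the transfer F ⇝ ℚ along an arbitrary (non-normal, insoluble-closure) extension
is a statement about M(ℚ_p) = GL_n(F_p)-equivariant pieces of Ĥ^*(GL_(nd)/ℚ) and of Ĥ^*(Res GL_n/F),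
not about a trace-formula comparison; the characteristic-0 shadow
is governed by the DEFECT SPLITTING identity l₀(GL_(nd)/ℚ) = l₀(Res_(F/ℚ)GL_n) + rank 𝒪_F^× ⇔ (n
even ∨ r₁(F) ≤ 1) (support DefectSplitting, proved in the planner's
Sketch.lean), which says the Galois-theoretic induced locus Ind_F^ℚ(trianguline deformations of σ)
has the full Hansen–Newton dimension dim 𝒲 − l₀ of the GL_(nd)/ℚ
eigenvariety exactly then — induced loci are whole components (CM-like) and occurrence propagates
from one seed point by R^tri = 𝕋 rigidity, instead of needing dense
classical points (there are none: strong purity + Baker–Brumer make every arithmetic weight on the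
induced locus parallel, hence singular — Calegari–Mazur's 'genuinely
p-adic' situation, CalegariMazur2008 §1.1). Sources: CalegariMazur2008 (speculation on p-adic
functoriality; GL₁ over non-CM fields), HansenUniversalEigenvarieties2017
(Conj. 1.2.3, Thm 1.1.6, Thm 5.1.6), Scholze2015 §V.4, Ash2003 and TreumannVenkatesh2016 (the
Smith-theory cousin: twisted Levis fixed by an order-p automorphism),
AshDoudPollack2002 §7.1 (numerical instance: Ind from the complex cubic of discriminant −59 occurs
mod 7), CalegariGeraghty2017 (Conj. A over any F), BellaicheDimitrov2016
(the RM weight-one analogue of an induced locus that is too small). Imported areas: p-adic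
representation theory (Emerton's Jacquet functor / parabolic induction at p),
Galois deformation theory (dimension counts, Leopoldt/Baker–Brumer), topology of arithmetic groups
(torsion classes). What prior routes do not do: BaseFieldAscent and
LiftDescend move the field variable only through CLASSICAL cyclic (Arthur–Clozel) layers and leave
simple-group functoriality as a bare crux; TwistAveragedDeinduction (this
seat's earlier operator-C product) induces to ℚ ANALYTICALLY (Cogdell–Piatetski-Shapiro converse
conjecture), which cannot see torsion and needs AI(π) as a classical
automorphic representation; SmithKummerSeed's mod-p induction needs an automorphism of order p
(pure/Kummer fields, p = the degree); none uses a split prime, the Levi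
structure at p, or induced eigenvariety components, and none yields Calegari–Geraghty's Conjecture A
(Galois representations for TORSION classes) over non-CM fields,
which this line reduces to Scholze's theorem over ℚ plus de-induction.

RANKED CRUXES. #2 TorsionLeviInduction (crux) — TORSION TWISTED-LEVI INDUCTION. For every number
field F and n ≥ 1 with (n even ∨ F has at most one real place) — exactly the condition making every
Ind_F^ℚ of an odd σ̄ odd (|tr c| ≤ 1) and the condition of DefectSplitting — every prime p
completely split in F, finite S, level K = K_S·∏_(v∉S) GL_n(𝒪_v) ⊆ GL_n(𝒪̂_F), uniformisers ϖ, field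
k of characteristic p and eigenvalue system a occurring in some H^i(X_K, k) (a non-zero simultaneous
eigenclass in `ArithmeticQuotient.cohomology` for Scholze's double-coset operators T^(j)_v, v ∉ S, 1
≤ j ≤ n — the body of `HeckeEigenvaluesOccurGL` inlined, rev 3): there are S', K' (same shape), ϖ',
i', b with b occurring in H^(i')(X_K', k) for GL_(n[F:ℚ])/ℚ and, for every v ∉ S' (all w ∣ v outside
S), the Scholze-polynomial identity P_v(b)(X) = ∏_(w∣v) P_w(a)(X^f(w∣v)), P(X) = 1 + Σ_j (−1)^j
q^(j(j+1)/2) a_j X^j (`scholzeHeckePolynomial` inlined) — the mod-p eigensystem of Ind_F^ℚ.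
Definitionally the rev-2 statement (Iff.rfl). [difficulty: open-problem] (why it might fail: No
engine yet (restriction to the twisted Levi is not Hecke-equivariant; no classical points to
interpolate: purity + Baker–Brumer); FALSE if a torsion class over a non-CM F has no Galois rep (¬CG
Conj. A), or one that is even at the real place (n odd, r₁ = 1: oddness over F is conjectural).)
[CalegariMazur2008, HansenUniversalEigenvarieties2017, Scholze2015, Ash2003, TreumannVenkatesh2016,
CalegariGeraghty2017, AshStevens1986]
#3 MonomialSerreAtSplitPrimes (crux) — SERRE-TYPE OCCURRENCE FOR MONOMIAL REPRESENTATIONS AT A SPLIT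
PRIME (the n = 1 instance of the lever, F-side supplied by class field theory; rev 4 re-typing in
the same Scholze-adelic vocabulary as #2): F a number field of degree d = [F:ℚ] ≥ 2 with at most one
real place, p odd and completely split in F, k algebraically closed of characteristic p (discrete),
χ : Γ_F → k^× continuous with Frobenius values c_w off a finite Sχ. Then some eigenvalue system b
occurs in H^(i')(X_K', k) for GL_d/ℚ (K' ⊇ K'_(S')·∏_(v∉S') GL_d(ℤ_v), Scholze's T^(j)_v) with, for
every v ∉ S' (all w ∣ v outside Sχ), P_v(b)(X) = ∏_(w∣v) (1 − c_w⁻¹ X^f(w∣v)) = det(1 − X·(Ind_F^ℚ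
χ)(Frob_v^geom)) — i.e. Scholze's σ_b IS Ind χ. d = 1 is excluded (vacuous for the lever;
parity-obstructed: for GL₁/ℚ with trivial coefficients and p odd only even ψ̃ occur in H^* = H⁰, so
σ_ψ = ψ̃Art⁻¹ ⊗ χ_cyc⁻¹ is always odd and χ = 1 would refute a d = 1 clause); for d ≥ 2, r₁ ≤ 1
makes (Ind χ)(c) alternating up to sign for every χ (the Caraiani–Le Hung parity of torsion
eigenclasses is met). Ash 2003 Thm 1.1 is the cyclotomic Smith-prime instance, ADP 2002 §7.1 the
complex-cubic numerical one. [difficulty: XL] (why it might fail: Generalised Serre (weak form) for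
GL_d/ℚ is OPEN for d ≥ 3 (AshSinnott2000, ADP Conj. 3.1; evidence Ash2003, ADP §7.1); for d = 2 the
reducible Ind χ = χ₀ ⊕ χ₀ε_F needs Eisenstein eigensystems with trivial coefficients — a
level/degree slip in the adelic typing could falsify it.) [Ash2003, AshSinnott2000,
AshDoudPollack2002, Scholze2015, CaraianiLehung2016, AshStevens1986, TreumannVenkatesh2016]
#4 LanglandsOverQ (crux) — Reciprocity over ℚ, all n, all weights, both directions, all places: ∃ 𝓡
∀ n > 0 ∀ hcpt, GlobalLanglandsCorrespondenceGLn n ℚ 𝓡 hcpt — the archimedean core (Maass λ = 1/4,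
even Artin, Hodge-irregular ρ) that every route carries; stated with the SAME signature as
TwistAveragedDeinduction.LanglandsOverQ so the item is shared, not duplicated. Needed here twice:
(B)/ℚ turns Ind_F^ℚ ρ_(π,p) (p split) into an automorphic Π on GL_(nd)/ℚ (non-normal automorphic
induction as a by-product) and (A)/ℚ then supplies ρ_(π,ℓ) at the non-split ℓ. [difficulty:
open-problem] (why it might fail: Contains the irregular core over ℚ (NonRegularWeightBarrier: Maass
λ=1/4, even icosahedral Artin — no engine in this route); FALSE as typed if Buzzard–Gee Conj. 3.1.5
fails (an L-algebraic π with non-algebraic Satake parameter has no ρ_(π,ι) for generic ι).)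
[BuzzardGeeLMS2014, Calegari2023, Scholze2015,
Literature.Barriers.Langlands.NonRegularWeightBarrier]
#9 DefectSplitting (support) — DEFECT SPLITTING (numerology of the line, provable now; proved in the
planner's Sketch.lean by omega): for n ≥ 1 and r₁ + r₂ ≥ 1, l₀(GL_(n(r₁+2r₂))/ℚ) = l₀(Res_(F/ℚ)GL_n)
+ (r₁ + r₂ − 1) holds iff n is even or r₁ ≤ 1, with l₀ = the barrier file's `defectGL` (Khare–Thorne
(6.2)). Reading: dim of the induced locus (Hansen–Newton count over F) = expected dimension over ℚ
exactly then. [difficulty: provable-now] [KhareThorne2017, HansenUniversalEigenvarieties2017,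
CalegariMazur2008, BellaicheDimitrov2016]
#9 Deinduction (support, REFUTED-misstated 2026-08-17T01:02Z by
Summit.Langlands.Langlands.Theorems.SplitPrimeInductionDeinduction_refuted, p135051; settled
negative: this route's want dropped at rev 8, so the gate-written file keeps the old text only as a
comment — the refuting Theorems file re-acquires the constant from the Record module attached as
evidence on stmt-Langlands-16822 when it is next rebuilt; no longer a hypothesis of anything) — the
first typing of Galois de-induction let the hypothesis hold off a finite exceptional set T (per
twist χ) but asked the conclusion at EVERY place not above S; witness: F = ℚ, d = n = 1, k = ℚ̄
discrete, S = ∅, Frobenius data P v₀ = X (determinant 0) at one place and X − 1 elsewhere —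
hypothesis met by R := χ, T := {v₀}, conclusion impossible at v₀. [Taylor1994, BoxerEtAl2021,
Scholze2015]
#9 DeinductionR (support) — GALOIS DE-INDUCTION along a non-normal extension with a UNIFORM
exceptional set (rev 9; rev 7 was the refuter's C′ with a per-twist exceptional set, FALSE for n ≥ 2
— see below): F of degree d, n ≥ 1, k algebraically closed discrete, S finite, monic degree-n
polynomials P_w, T a finite set of rational places. If for EVERY continuous character χ of Γ_F
(Frobenius values c_w off S_χ) there is a semisimple R_χ : Γ_ℚ → GL_(dn)(k), unramified with
charpoly(R_χ(Frob_v)) = ∏_(w∣v) (P_w scaled by c_w)(X^f_w) at EVERY v ∉ T above which S ∪ S_χ is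
avoided (one T for all twists; cond χ is the separate guard S_χ), then there are σ : Γ_F → GL_n(k)
and a finite T′ such that σ is unramified with charpoly(Frob_w) = P_w at every w lying over a
rational prime v ∉ T′ above which no place of S lies. The per-twist form (∀ χ ∃ R T) is refuted on
paper by a sparse adversary (evidence note on the item): F = ℚ(i), σ an A₅-type Artin representation
of Γ_F with cL ≠ L, Frobenius data of σ with P_(w_i) ↔ P_(w̄_i) SWAPPED along a density-zero
sequence of split places chosen by Chebotarev so that the first i characters agree on w_i, w̄_i
while charpoly σ(Frob_(w_i)) ≠ charpoly σ(Frob_(w̄_i)); every χ_j is served by R := Ind(σ ⊗ χ_j),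
T_j := {v_1, …, v_(j−1)} (a swap is invisible to χ iff χ(w) = χ(w̄)), yet any σ′ matching the data
off a finite set agrees with σ on a density-one set and therefore fails at every w_i (n = 1 is
immune: σ is then one of the χ_j). With T uniform the twists with χ(w_i) ≠ χ(w̄_i) unramified above
v_i must also be matched, which pins the data place by place; the junction supplies a uniform T
(level of the twisted induced eigensystem = S ∪ cond χ ∪ {p} ∪ Ram(F/ℚ)). The rev-9 text is a
weakening of the rev-7 text (planner Sketch.lean, old_implies_new, rc 0). Why it might still fail:
de-induction from ABELIAN twists for n ≥ 2 along a non-normal F is not in the literature in this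
generality (Taylor 1994 §3 is K imaginary quadratic from GSp₄); a non-induced R_1 of induced
Frobenius shape for all twists would break it; char 2 with d even needs care. [difficulty: L]
[Taylor1994, BoxerEtAl2021, Scholze2015,
Summit.Langlands.Langlands.Theorems.SplitPrimeInductionDeinduction_refuted]
#1 Assembly (assembly) — THE JUNCTION = OUT-OF-SCOPE REMAINDER (honest, summit-strength, never
staffed from this route; same convention as E8QuinticResidue.SectorComplement /
TwistAveragedDeinduction.AJunction; rev 6: the former support item SectorChain,
stmt-Langlands-16823, merged into the assembly item because the old Assembly L → T → M → D →
SectorChain → Langlands was a propositional tautology — ground.trivial, the route's only blocking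
ground flag — and an assembly item cannot be dropped): TorsionLeviInduction →
MonomialSerreAtSplitPrimes → LanglandsOverQ → DeinductionR → Langlands; `closes` is this implication
applied. Informal content it hides, in order of use: Scholze's determinants over ℚ (named fact
Scholze2015_galoisRep_of_modPEigensystem at F = ℚ) applied to the induced eigensystems of all
twists; DeinductionR ⇒ σ̄ for every torsion class over every F (CG Conj. A, existence); the
characteristic-0 version by m → ∞ along INDUCED COMPONENTS (informal crux
InducedComponentPropagation, filed after open); local–global compatibility transported from the
ℚ-side; (A) over F for cohomological π, then (B)/ℚ on Ind ρ_(π,p) for the other ℓ; (B) over F by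
Calegari–Geraghty patching in defect l₀(F) (needs the CG vanishing range over F, no engine here) or
by p-adic descent through the same Levi; irregular π over totally imaginary F by occurrence in
completed cohomology (parity-free), real places by quadratic patching (Sorensen) and cyclic descent.
[difficulty: open-problem] [Scholze2015, CalegariGeraghty2017, ACCGHLNSTT2023, Taylor1994,
BuzzardGeeLMS2014]

TWO-LAYER PLAN. Foreseen glued splits (nothing filed now): TorsionLeviInduction ⇐
(JacquetModuleComparison: an M(ℚ_p)×𝕋^S-equivariant relation between the P-ordinary part of
Ĥ^*(GL_(nd)/ℚ) and Ĥ^*(Res GL_n/F) at a split p) → (InducedComponentPropagation: R^tri = 𝕋 rigidity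
along induced components, seeds at Rankin–Selberg / Eisenstein points) → TorsionLeviInduction;
MonomialSerreAtSplitPrimes ⇐ (complex cubic d = 3 case) → (general r₁ ≤ 1) by the same propagation
from the Ash–Doud reducible seed Ind 1 = 1 ⊕ ρ_(S₃).

KILL CRITERIA. A refutation of MonomialSerreAtSplitPrimes by a certified census (a monomial ρ̄ =
Ind_F^ℚ χ̄, F with r₁ ≤ 1, p split, whose induced eigensystem is absent from H^*(X_K', 𝔽̄_p) of
GL_d/ℚ for every level K' — e.g. via an Ash–Gunnells–McConnell computation contradicting the
predicted eigenvalues at every level dividing the Artin bound (Betti cohomology of Γ ⊂ SL_d(ℤ)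
computes the adelic H^* componentwise)) closes the route `refuted:MonomialSerreAtSplitPrimes` (it is
the n = 1 case of the lever). A torsion class over some F provably WITHOUT Galois representation
(¬CG Conj. A) refutes TorsionLeviInduction — close refuted. If InducedComponentPropagation is shown
to need dense classical points (i.e. reduces to Hansen Thm 5.1.6) the mechanism is empty: route →
dormant. LanglandsOverQ refuted as typed (BG 3.1.5 failure) breaks every field-variable route at
once; repair by the L-algebraic/C-arithmetic restatement.

NOT DECOMPOSED YET. The characteristic-0 propagation statement (induced loci are unions of
irreducible components of the trianguline/ordinary deformation space of Ind σ̄ when n even ∨ r₁ ≤ 1;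
needs char-0 deformation functors at a ℚ̄_p-point, not in the tree) — filed informally after open;
the M(ℚ_p)-equivariant comparison map (needs Emerton's J_P on completed cohomology, not in the
tree); local–global compatibility transport; the CG vanishing range over F; twisting of mod-p
eigenclasses by characters (level bookkeeping) used inside the junction (Assembly).

CHEAPEST FALSIFIER. ADP 2002 §7.1 (doi:10.1215/s0012-9074-02-11235-6): ρ̄ = Ind_(K₃)^ℚ χ, K₃ the
complex cubic field of discriminant −59, χ of order 9, p = 7 — the predicted GL₃/ℚ eigenclasses WERE
found (level 59, weights F(3,2,0)⊗det^e, eigenvalues checked to ℓ = 47): the n = 1 lever passes its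
one published test (there p ramifies in χ; the split-prime case is untested). Next cheapest (kit job
for a refuter, not run here — no GL₃ cohomology code on the lane): F = ℚ(α), α³ − α − 1 = 0 (disc
−23), p ∈ {59, 101, 167} (completely split), χ a ray-class character of F of prime conductor 𝔮 ∤ 23p
(h(F) = 1; choose 𝔮 of norm 7, 11 or 17 with (𝒪_F/𝔮)^×/⟨±α^ℤ⟩ ≠ 1): compute H³(Γ₀(23·N𝔮) ⊂ SL₃(ℤ),
𝔽̄_p) Hecke eigenvalues (Ash–Gunnells–McConnell sharbly code) and look for T(ℓ,1), T(ℓ,2) =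
coefficients of ∏_(w∣ℓ)(1 − χ(w)X^f_w).

NUMBERS. l₀(Res_(F/ℚ)GL_n) = r₁⌊(n−1)/2⌋ + r₂(n−1) (KhareThorne2017 (6.2)); dim 𝒲_F = n[F:ℚ] − rank
𝒪_F^× (Leopoldt), Hansen–Newton dim ≥ dim 𝒲 − l₀ (HansenUniversalEigenvarieties2017 Thm 1.1.6);
p-adic characters of Γ_F: 1 + r₂ dimensions vs 1 classical (CalegariMazur2008 §1.1); complex cubic
F: l₀ = 1, dim 𝒲 = 5, induced locus in GL₆/ℚ of dim 4 = 6 − l₀(GL₆/ℚ) = 6 − 2. Items at open: 7 (3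
cruxes, 3 support, 1 assembly) + 1 informal crux after open; rev 5 (cone route-repair): #2 restated
definitionally, #3 re-typed, two convenience imports dropped; rev 6 (ground route-repair, unit
rground-Langlands-SplitPrimeInduction-b056c6f0): the tautological Assembly (L → T → M → D →
SectorChain → Langlands; ground.trivial by `tauto`, the only BLOCKING ground flag) restated 1:1 as
the junction itself (hypotheses in rank order T → M → L → D, because items are shared by statement
and SectorChain's verbatim form could not be re-filed while SectorChain was being dropped), the
support item SectorChain (stmt-Langlands-16823) dropped as its duplicate, `closes` re-certified on
(hA : Assembly) — items then 3 cruxes + 2 typed support (DefectSplitting, Deinduction) + 1 informal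
+ Assembly; rev 7 (same unit, REPAIR of the BROKEN state raised at 01:02Z while rev 6 was in
flight): Deinduction refuted-misstated ⇒ repaired statement filed as the NEW support item
DeinductionR, Assembly restated to T → M → L → DeinductionR → Langlands and `closes` re-certified on
(h₄ : DeinductionR); rev 8 (same unit): the route's want of the refuted Deinduction dropped (clears
BROKEN; the file keeps its text as a comment only, so the refuting Theorems file needs the Record
module + one import line attached as evidence on stmt-Langlands-16822 — fullbuild fix / migrate-pool
territory, planners do not write under Theorems); rev 9 (unit
rfix-Langlands-SplitPrimeInduction-b056c6f0): DeinductionR restated 1:1 (same decl name, Assembly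
and `closes` untouched) with a UNIFORM exceptional set because the rev-7 per-twist form is false for
n ≥ 2 (sparse swap adversary, see #9 above and the item's evidence) — items now 3 cruxes + 2 live
typed support (DefectSplitting, DeinductionR) + 1 informal + Assembly, plus the settled negative
Deinduction in the ledger. The two cruxes exceed the ground battery's term-size cap
(Expr.sizeWithoutSharing 251215 / 163451 > h21.ground.maxSize 100000 ⇒ ground.skipped:
informational, not blocking — cf. KleinTorsionDoor, ground ok with two skipped cruxes of size
8.9·10⁶); they are vetted by refuters reading the text, and a compact re-typing was deliberately NOT
done here: it needs either `import ScholzeTorsionGalois`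
(HeckeEigenvaluesOccurGL/scholzeHeckePolynomial sit in the module of the closed named fact) or the
SL_m(ℤ)/nebentype vocabulary `TorsionHeckeEigensystem.Occurs` (T(ℓ,m) = 1 plus ⟨ℓ⟩, versus the
adelic T^(m)_ℓ = central action: a change of convention, not a faithful restatement).

DEFINITION REQUESTS. None needed to state the cruxes: `ArithmeticQuotient.cohomology/heckeEnd`,
`GLn.sndHom`, `heckeDiagAt`, `glFiniteIntegralLevel`, `FramedGaloisRep` (+ `IsUnramifiedAt`,
`HasFrobCharpolyAt`), `defectGL` all exist in fact-free modules. Wanted later (not filed now):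
Emerton's Jacquet functor J_P on completed cohomology; characteristic-0 trianguline deformation
functor at a point (for InducedComponentPropagation). CONE REPAIR (rev 3–5, unit
rrepair-Langlands-SplitPrimeInduction-b056c6f0): the rev-2 import cone carried 40 unproved named
facts — 14 in the Statement's own cone (shared by every Langlands route) and 26 riding in on two
convenience imports: `AshSmithTheoryHecke` (Ash2003.cohomology/IsAttached; via InducedGaloisRep →
ArtinRestriction → ProjectiveType/KummerUnramified and RayClassGroupFinite it drags StrongArtinGL2
×6, TunnellOctahedralGlobal ×2, TunnellLemma ×2, Sweep1 ×3, Sweep1Proofs, ArtinLFunctions ×2,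
LanglandsTunnell, NewformGaloisRep ×3, CuspFormLFunction ×2, AnalyticRank, HeckeCharacter, Ash2003 —
none load-bearing for any item) and `ScholzeTorsionGalois`
(HeckeEigenvaluesOccurGL/scholzeHeckePolynomial live next to the named fact
Scholze2015_galoisRep_of_modPEigensystem, which is used only INSIDE the informal junction — now the
Assembly item — as a hypothesis a prover imports in a Theorems file, never by the route file). Both
imports are dropped; route imports are now ArithmeticQuotientCohomology, GLnAdelicStructure,
Barriers.TaylorWilesNumericalCoincidence (defectGL; its two barrier Props are `_holds`-discharged)
and the two *Proofs modules that discharge the Statement cone's cite_only deps (rev-1 device).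
needs-fact: none beyond the Statement's own cone (shared by every Langlands route).

Novelty: Searches (2026-08-16/17): `lit search --hybrid` ×4 ("p-adic automorphic induction eigenvariety
functoriality non-Galois extension": 12 book hits, none relevant; "Hansen universal
eigenvarieties…", "Bellaiche Dimitrov eigencurve weight one RM", "Calegari Mazur nearly ordinary
arbitrary number fields"); `lit search --source zbmath` ×7 ("p-adic functoriality": 25 rows →
CalegariMazur2008, Breuil–Schneider, TreumannVenkatesh2016, Hansen2017; "Serre conjecture GL(3)
induced": 1; "Ash Doud reducible…": 4 Ash–Doud papers; "Smith theory Hecke operators Ash": Ash2003;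
"three-dimensional Galois representations arithmetic cohomology": Doud 2002, ADP 2002); `lit galaxy
search --star all` ×3 ("p-adic functoriality": 1 pdf = Johansson–Newton MRL 2019; "non-parallel
weight": 2; "nearly ordinary Galois deformations over arbitrary number fields": 0); `lit read
arxiv:1412.1533` (Hansen: Conj. 1.2.2–1.2.5, §1.3, §5 — interpolation from classical functoriality
only; mentions Res_(F/ℚ)H for F with one complex place as l = 1 example), `lit read arxiv:0708.2451`
(Calegari–Mazur §1.1 in full), `lit read arxiv:math/0102233` (ADP §7.1 induced example);
openalex/s2/arxiv remote tiers unavailable this session (503/429/timeout, recorded). In-tree: all 70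
Langlands theses headers, Ash2003/ScholzeTorsionGalois/ModPHeckeEigensystemGL/Eigenvariety(ResGLn)
modules, 13 barrier blocks.
Nearest prior art found: CalegariMazur2008 §1.1 (p-adic automorphic forms should obey functoriality;
GL₂/K → GSp₄/ℚ via Ind for  [refs: 1412.1533, 0708.2451, math/0102233, arxiv:1412.1533, arxiv:0708.2451, arxiv:math/0102233, CalegariMazur2008, TreumannVenkatesh2016, Hansen2017, Ash2003, HansenUniversalEigenvarieties2017]

Barriers (technique_class: torsion-functoriality completed-cohomology levi-at-p): - technique_class: torsion-functoriality completed-cohomology levi-at-p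
- Literature.Barriers.Langlands.ShimuraVarietyRealizationBarrier: applies head-on (its Narrow
`blocks` clause names the torsion analogue over fields with [K:K⁺] ≥ 3); EVADED — nothing is
realised over F or over any CM field; the eigensystem is moved at a split prime into GL_(nd)/ℚ, over
the totally real field ℚ where the barrier's own evasions (HLTT/Scholze boundary of U(nd,nd)/Sp)
live; its untested lead (d) (Treumann–Venkatesh at the Kummer prime) is the Smith-theory cousin,
replaced here by a split prime available for every F.
- Literature.Barriers.Langlands.ShimuraVarietyRealizationBarrierNarrow: same; the multiplicity-d
degeneracy (conjuncts (ii)–(iv)) is exactly why the transfer is typed in TORSION (trivial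
coefficients, all levels at p) and never as a classical automorphic induction.
- Literature.Barriers.Langlands.NonRegularWeightBarrier: the classical shadow AI(π) is
non-cohomological over ℚ (purity) — not used; torsion/completed cohomology carries singular
eigensystems (Narrow conjunct (1)); the barrier BITES on LanglandsOverQ (irregular core over ℚ), not
evaded, shared with every route.
- Literature.Barriers.Langlands.NonRegularWeightBarrierNarrow: idem; no classicality statement with
target H^*(X, V_λ) is a crux of this route.
- Literature.Barriers.Langlands.SolvableImageBarrier: EVADED by construction — no base change /
automorphic induction / descent along any layer of F/ℚ; a completely spli

History (route lifecycle, newest last):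
- 2026-08-17T01:08:21Z · rev 6: restated Assembly (stmt-Langlands-16824) — route-repair (ground-failed), rev 6: the only BLOCKING ground flag was Assembly ground.trivial (tauto) — Assembly := L → T → M → D → SectorChain → Langlands wit (planner-rground-Langlands-SplitPrimeInduction-b056c6f0-0)
- 2026-08-17T01:08:21Z · rev 6: dropped SectorChain — route-repair (ground-failed), rev 6: the only BLOCKING ground flag was Assembly ground.trivial (tauto) — Assembly := L → T → M → D → SectorChain → Langlands wit (planner-rground-Langlands-SplitPrimeInduction-b056c6f0-0)
- 2026-08-17T01:15:25Z · rev 7: restated Assembly (stmt-Langlands-17071) — repair (rev 7): Deinduction (stmt-Langlands-16822, support) refuted-misstated by Summit.Langlands.Langlands.Theorems.SplitPrimeInductionDeinduction_refuted (p13 (planner-rground-Langlands-SplitPrimeInduction-b056c6f0-0)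
- 2026-08-17T01:16:51Z · rev 8: dropped Deinduction — repair (rev 8, clears BROKEN): drop this route's want of the refuted-misstated support item Deinduction (stmt-Langlands-16822; Summit.Langlands.Langlands.Theore (planner-rground-Langlands-SplitPrimeInduction-b056c6f0-0)
- 2026-08-17T01:16:51Z · REPAIRED (drop Deinduction) — back to open: repair (rev 8, clears BROKEN): drop this route's want of the refuted-misstated support item Deinduction (stmt-Langlands-16822; Summit.Langlands.Langlands.Theore (planner-rground-Langlands-SplitPrimeInduction-b056c6f0-0)
- 2026-08-17T01:28:08Z · rev 9: restated DeinductionR (stmt-Langlands-17127) — @note_restate.txt (planner-rfix-Langlands-SplitPrimeInduction-b056c6f0-0)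
- 2026-08-17T07:30:51Z · BROKEN — MonomialSerreAtSplitPrimes (stmt-Langlands-16951, crux) refuted by Summit.Langlands.Langlands.Theorems.SplitPrimeInductionMonomialSerreAtSplitPrimes_refuted @ 8f4d7b37d700 (refuter-rattack-stmt-Langlands-16951-0)
- 2026-08-20T07:33:32Z · CLOSED refuted — refuted:stmt-Langlands-16951 (MonomialSerreAtSplitPrimes) by Summit.Langlands.Langlands.Theorems.SplitPrimeInductionMonomialSerreAtSplitPrimes_refuted (grace expired, auto-close) (gate)

sub-problem: Langlands · status: closed(refuted) · opened planner-plan-novel-Langlands-Langlands-e266a39d-c-v2-g6-0 2026-08-17T00:28:46Z · rev 11 · ledger route-Langlands-SplitPrimeInduction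
GENERATED by the gate from the ledger (D-0016/17). Provers cite these decls: `theorem foo : Summit.Langlands.Langlands.Theses.SplitPrimeInduction.<Decl> := …` in Summits/Langlands/Langlands/Theorems/<Name>.lean.
-/

namespace Summit.Langlands.Langlands.Theses.SplitPrimeInduction

open scoped BigOperators Topology Manifold Classical MeasureTheory ProbabilityTheory Matrix InnerProductSpace ComplexConjugate ContinuousMap
open Filter Set Function TopologicalSpace MeasureTheory

attribute [summit_statement] _root_.Langlands

-- earlier TorsionLeviInduction (stmt-Langlands-16819, replaced 2026-08-17T00:50:11Z -> stmt-Langlands-16942): retired by None — ∀ (F : Type) [Field F] [NumberField F] (n : ℕ), 1 ≤ n → (Even n ∨ NumberField.InfinitePlace.nrRealPlaces F ≤ 1) → ∀ (p : ℕ) [Fact p.Prime], (∀ v : IsDedekindDomain.HeightOneSpectrum (NumberField.RingOfIntegers F), ((p : ℕ) : NumberField.RingOfIntegers F) ∈ v.asIdeal → v.asI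
/-- item stmt-Langlands-16942 · crux · rank 2 · closed · moot by None · by planner
why it might fail: No engine yet (restriction to the twisted Levi is not Hecke-equivariant; no classical points to interpolate: purity + Baker–Brumer); FALSE if a torsion class over a non-CM F has no Galois rep (¬CG Conj. A), or one that is even at the real place (n odd, r₁ = 1: oddness over F is conjectural).
sources: CalegariMazur2008, HansenUniversalEigenvarieties2017, Scholze2015, Ash2003, TreumannVenkatesh2016, CalegariGeraghty2017
[crux] TORSION TWISTED-LEVI INDUCTION. For every number field F and n ≥ 1 with (n even ∨ F has at
most one real place) — exactly the condition making every Ind_F^ℚ of an odd σ̄ odd (|tr c| ≤ 1) and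
the condition of DefectSplitting — every prime p completely split in F, finite S, level K =
K_S·∏_(v∉S) GL_n(𝒪_v) ⊆ GL_n(𝒪̂_F), uniformisers ϖ, field k of characteristic p and eigenvalue
system a OCCURRING in some H^i(X_K, k) (a non-zero class c ∈ H^i(X_K, k) =
`ArithmeticQuotient.cohomology` for GL_n(F) → GL_n(𝔸_F,f), simultaneous eigenvector of Scholze's
double-coset operators T^(j)_v = [K·diag(ϖ_v ×j, 1 ×(n−j))·K] (`heckeEnd` of `GLn.sndHom
(heckeDiagAt v ϖ_v j)`), v ∉ S, 1 ≤ j ≤ n, with T^(j)_v c = a_(v,j) c): there are S', K' (same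
shape), ϖ', i', b with b occurring in H^(i')(X_K', k) for GL_(n[F:ℚ])/ℚ and, for every v ∉ S' (all w
∣ v outside S), the Scholze-polynomial identity P_v(b)(X) = ∏_(w∣v) P_w(a)(X^f(w∣v)), P(X) = 1 +
Σ_(j≥1) (−1)^j q^(j(j+1)/2) a_j X^j = det(1 − X·Frob^geom) — the mod-p eigensystem of Ind_F^ℚ. REV 3
(route-repair, cone): the bodies of `HeckeEigenvaluesOccurGL` and `scholzeHeckePolynomial` (module
ScholzeTorsionGalois, which carries the unproved named fact S -/
@[route_item "route-Langlands-SplitPrimeInduction", crux]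
def TorsionLeviInduction : Prop :=
  open Literature.NumberTheory.Automorphic Literature.NumberTheory.GaloisRepresentations IsDedekindDomain NumberField Polynomial in ∀ (F : Type) [Field F] [NumberField F] (n : ℕ), 1 ≤ n → (Even n ∨ InfinitePlace.nrRealPlaces F ≤ 1) → ∀ (p : ℕ) [Fact p.Prime], (∀ v : HeightOneSpectrum (𝓞 F), ((p : ℕ) : 𝓞 F) ∈ v.asIdeal → v.asIdeal.ramificationIdx ℤ = 1 ∧ v.asIdeal.inertiaDeg ℤ = 1) → ∀ (S : Finset (HeightOneSpectrum (𝓞 F))) (K : Subgroup (GL (Fin n) (FiniteAdeleRing (𝓞 F) F))) (ϖ : ∀ v : HeightOneSpectrum (𝓞 F), (v.adicCompletion F)ˣ), (∀ v, Valued.v ((ϖ v : (v.adicCompletion F)ˣ) : v.adicCompletion F) = WithZero.exp (-1 : ℤ)) → IsOpen (K : Set (GL (Fin n) (FiniteAdeleRing (𝓞 F) F))) → K ≤ glFiniteIntegralLevel n F → (∀ g ∈ glFiniteIntegralLevel n F, (∀ v ∈ S, ∀ i j : Fin n, ((g : Matrix (Fin n) (Fin n) (FiniteAdeleRing (𝓞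 F) F)) i j) v = (1 : Matrix (Fin n) (Fin n) (v.adicCompletion F)) i j) → g ∈ K) → ∀ (k : Type) [Field k] [CharP k p] (i : ℕ) (a : HeightOneSpectrum (𝓞 F) → ℕ → k), (∃ c : ArithmeticQuotient.cohomology k (Matrix.GeneralLinearGroup.map (algebraMap F (FiniteAdeleRing (𝓞 F) F))) K k i, c ≠ 0 ∧ ∀ v ∉ S, ∀ j : ℕ, 1 ≤ j → j ≤ n → ArithmeticQuotient.heckeEnd k K (GLn.sndHom n F (heckeDiagAt n F v (ϖ v) j)) k (Matrix.GeneralLinearGroup.map (algebraMap F (FiniteAdeleRing (𝓞 F) F))) i c = a v j • c) → ∃ (S' : Finset (HeightOneSpectrum (𝓞 ℚ))) (K' : Subgroup (GL (Fin (n * Module.finrank ℚ F)) (FiniteAdeleRing (𝓞 ℚ) ℚ))) (ϖ' : ∀ v : HeightOneSpectrum (𝓞 ℚ), (v.adicCompletion ℚ)ˣ) (i' : ℕ) (b : HeightOneSpectrum (𝓞 ℚ) → ℕ → k), (∀ v, Valued.v ((ϖ' v : (v.adicCompletion ℚ)ˣ) : v.adicCompletion ℚ) = WithZero.exp (-1 :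 ℤ)) ∧ IsOpen (K' : Set (GL (Fin (n * Module.finrank ℚ F)) (FiniteAdeleRing (𝓞 ℚ) ℚ))) ∧ K' ≤ glFiniteIntegralLevel (n * Module.finrank ℚ F) ℚ ∧ (∀ g ∈ glFiniteIntegralLevel (n * Module.finrank ℚ F) ℚ, (∀ v ∈ S', ∀ i j : Fin (n * Module.finrank ℚ F), ((g : Matrix (Fin (n * Module.finrank ℚ F)) (Fin (n * Module.finrank ℚ F)) (FiniteAdeleRing (𝓞 ℚ) ℚ)) i j) v = (1 : Matrix (Fin (n * Module.finrank ℚ F)) (Fin (n * Module.finrank ℚ F)) (v.adicCompletion ℚ)) i j) → g ∈ K') ∧ (∃ c : ArithmeticQuotient.cohomology k (Matrix.GeneralLinearGroup.map (algebraMap ℚ (FiniteAdeleRing (𝓞 ℚ) ℚ))) K' k i', c ≠ 0 ∧ ∀ v ∉ S', ∀ j : ℕ, 1 ≤ j → j ≤ n * Module.finrank ℚ F → ArithmeticQuotient.heckeEnd k K' (GLn.sndHom (n * Module.finrank ℚ F) ℚ (heckeDiagAt (n * Module.finrank ℚ F) ℚ v (ϖ' v) j)) k (Matrix.GeneralLinearGroup.map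 (algebraMap ℚ (FiniteAdeleRing (𝓞 ℚ) ℚ))) i' c = b v j • c) ∧ ∀ v : HeightOneSpectrum (𝓞 ℚ), v ∉ S' → (∀ w : HeightOneSpectrum (𝓞 F), w.asIdeal.under (𝓞 ℚ) = v.asIdeal → w ∉ S) ∧ (1 + ∑ j ∈ Finset.Icc 1 (n * Module.finrank ℚ F), C ((-1 : k) ^ j * (v.residueCard : k) ^ (j * (j + 1) / 2) * b v j) * X ^ j : Polynomial k) = ∏ᶠ w ∈ {w : HeightOneSpectrum (𝓞 F) | w.asIdeal.under (𝓞 ℚ) = v.asIdeal}, (1 + ∑ j ∈ Finset.Icc 1 n, C ((-1 : k) ^ j * (w.residueCard : k) ^ (j * (j + 1) / 2) * a w j) * X ^ j : Polynomial k).comp (X ^ w.asIdeal.inertiaDeg (𝓞 ℚ))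

-- earlier MonomialSerreAtSplitPrimes (stmt-Langlands-16820, replaced 2026-08-17T00:50:35Z -> stmt-Langlands-16951): retired by None — ∀ (F : Type) [Field F] [NumberField F] (d : ℕ) (hd : Module.finrank ℚ F = d), NumberField.InfinitePlace.nrRealPlaces F ≤ 1 → ∀ (p : ℕ) [Fact p.Prime], p ≠ 2 → (∀ v : IsDedekindDomain.HeightOneSpectrum (NumberField.RingOfIntegers F), ((p : ℕ) : NumberField.RingOfIntege
/-- item stmt-Langlands-16951 · crux · rank 3 · closed · refuted by Summit.Langlands.Langlands.Theorems.SplitPrimeInductionMonomialSerreAtSplitPrimes_refuted @ 8f4d7b37d700 (refuter) · by planner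
why it might fail: Generalised Serre (weak form) for GL_d/ℚ is OPEN for d ≥ 3 (AshSinnott2000, ADP Conj. 3.1; evidence Ash2003, ADP §7.1); for d = 2 the reducible Ind χ = χ₀ ⊕ χ₀ε_F needs Eisenstein eigensystems with trivial coefficients — a level/degree slip in the adelic typing could falsify it.
sources: Ash2003, AshSinnott2000, AshDoudPollack2002, Scholze2015, CaraianiLehung2016, AshStevens1986
[crux] SERRE-TYPE OCCURRENCE FOR MONOMIAL REPRESENTATIONS AT A SPLIT PRIME (the n = 1 instance of
TorsionLeviInduction with the F-side supplied by class field theory; rev 3 re-typing in the same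
Scholze-adelic vocabulary). F a number field of degree d = [F:ℚ] ≥ 2 with at most one real place, p
odd and completely split in F, k algebraically closed of characteristic p with the discrete
topology, χ : Γ_F → k^× continuous (`FramedGaloisRep F k 1`) with Frobenius values c_w =
χ(Frob_w^arith) off a finite set Sχ (`IsUnramifiedAt`, `HasFrobCharpolyAt w (X − c_w)`). Then there
are a finite S', a level K' with K'_(S')·∏_(v∉S') GL_d(ℤ_v) ⊆ K' ⊆ GL_d(ℤ̂) open, uniformisers ϖ', a
degree i' and an eigenvalue system b OCCURRING in H^(i')(X_K', k) for GL_d/ℚ (non-zero simultaneous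
eigenclass of Scholze's T^(j)_v, v ∉ S', 1 ≤ j ≤ d — same inlined clause as in TorsionLeviInduction)
such that for every v ∉ S' all w ∣ v lie outside Sχ and P_v(b)(X) = 1 + Σ_j (−1)^j q_v^(j(j+1)/2)
b_(v,j) X^j = ∏_(w∣v) (1 − c_w⁻¹ X^f(w∣v)) = det(1 − X·(Ind_F^ℚ χ)(Frob_v^geom)); i.e. the Galois
representation Scholze attaches to b IS Ind_F^ℚ χ (Chebotarev + Brauer–Nesbitt). The case d = 1 (F =
ℚ) is excluded: it is vac -/
@[route_item "route-Langlands-SplitPrimeInduction", crux]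
def MonomialSerreAtSplitPrimes : Prop :=
  open Literature.NumberTheory.Automorphic Literature.NumberTheory.GaloisRepresentations IsDedekindDomain NumberField Polynomial in ∀ (F : Type) [Field F] [NumberField F], 2 ≤ Module.finrank ℚ F → InfinitePlace.nrRealPlaces F ≤ 1 → ∀ (p : ℕ) [Fact p.Prime], p ≠ 2 → (∀ v : HeightOneSpectrum (𝓞 F), ((p : ℕ) : 𝓞 F) ∈ v.asIdeal → v.asIdeal.ramificationIdx ℤ = 1 ∧ v.asIdeal.inertiaDeg ℤ = 1) → ∀ (k : Type) [Field k] [CharP k p] [IsAlgClosed k] [TopologicalSpace k] [DiscreteTopology k] (χ : FramedGaloisRep F k 1) (Sχ : Finset (HeightOneSpectrum (𝓞 F))) (c : HeightOneSpectrum (𝓞 F) → k), (∀ w ∉ Sχ, χ.IsUnramifiedAt w ∧ χ.HasFrobCharpolyAt w (X - C (c w))) → ∃ (S' : Finset (HeightOneSpectrum (𝓞 ℚ))) (K' : Subgroup (GL (Fin (Module.finrank ℚ F)) (FiniteAdeleRing (𝓞 ℚ) ℚ))) (ϖ' : ∀ v : HeightOneSpectrum (𝓞 ℚ), (v.adicCompletion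 ℚ)ˣ) (i' : ℕ) (b : HeightOneSpectrum (𝓞 ℚ) → ℕ → k), (∀ v, Valued.v ((ϖ' v : (v.adicCompletion ℚ)ˣ) : v.adicCompletion ℚ) = WithZero.exp (-1 : ℤ)) ∧ IsOpen (K' : Set (GL (Fin (Module.finrank ℚ F)) (FiniteAdeleRing (𝓞 ℚ) ℚ))) ∧ K' ≤ glFiniteIntegralLevel (Module.finrank ℚ F) ℚ ∧ (∀ g ∈ glFiniteIntegralLevel (Module.finrank ℚ F) ℚ, (∀ v ∈ S', ∀ i j : Fin (Module.finrank ℚ F), ((g : Matrix (Fin (Module.finrank ℚ F)) (Fin (Module.finrank ℚ F)) (FiniteAdeleRing (𝓞 ℚ) ℚ)) i j) v = (1 : Matrix (Fin (Module.finrank ℚ F)) (Fin (Module.finrank ℚ F)) (v.adicCompletion ℚ)) i j) → g ∈ K') ∧ (∃ e : ArithmeticQuotient.cohomology k (Matrix.GeneralLinearGroup.map (algebraMap ℚ (FiniteAdeleRing (𝓞 ℚ) ℚ))) K' k i', e ≠ 0 ∧ ∀ v ∉ S', ∀ j : ℕ, 1 ≤ j → j ≤ Module.finrank ℚ F → ArithmeticQuotient.heckeEnd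 k K' (GLn.sndHom (Module.finrank ℚ F) ℚ (heckeDiagAt (Module.finrank ℚ F) ℚ v (ϖ' v) j)) k (Matrix.GeneralLinearGroup.map (algebraMap ℚ (FiniteAdeleRing (𝓞 ℚ) ℚ))) i' e = b v j • e) ∧ ∀ v : HeightOneSpectrum (𝓞 ℚ), v ∉ S' → (∀ w : HeightOneSpectrum (𝓞 F), w.asIdeal.under (𝓞 ℚ) = v.asIdeal → w ∉ Sχ) ∧ (1 + ∑ j ∈ Finset.Icc 1 (Module.finrank ℚ F), C ((-1 : k) ^ j * (v.residueCard : k) ^ (j * (j + 1) / 2) * b v j) * X ^ j : Polynomial k) = ∏ᶠ w ∈ {w : HeightOneSpectrum (𝓞 F) | w.asIdeal.under (𝓞 ℚ) = v.asIdeal}, (1 - C (c w)⁻¹ * X ^ w.asIdeal.inertiaDeg (𝓞 ℚ) : Polynomial k)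

/-- item stmt-Langlands-16011 · crux · rank 4 · open · by planner
why it might fail: Contains the irregular core over ℚ (NonRegularWeightBarrier: Maass λ=1/4, even icosahedral Artin — no engine in this route); FALSE as typed if Buzzard–Gee Conj. 3.1.5 fails (an L-algebraic π with non-algebraic Satake parameter has no ρ_(π,ι) for generic ι).
sources: BuzzardGeeLMS2014, Calegari2023, Scholze2015, Literature.Barriers.Langlands.NonRegularWeightBarrier
[crux] THE SUMMIT OVER ℚ: reciprocity for GL_N over ℚ, both directions, all N, all weights,
local–global compatibility at every prime (the summit's `∀ F` instantiated at F := ℚ). It is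
consumed twice: (A)_ℚ in rank n[F:ℚ] turns the automorphic inductions of WeakInductionToQ into the
Galois family (InducedGaloisFamily), and (B)_ℚ makes every Rankin–Selberg inner product used by
TwistAverageExtraction an automorphic pole order; AJunction consumes it a third time for (B).
[difficulty: open-problem] -/
@[route_item "route-Langlands-SplitPrimeInduction", crux]
def LanglandsOverQ : Prop :=
  ∃ Rec : Summit.Langlands.ReciprocityData ℚ, ∀ n : ℕ, 0 < n → ∀ hcpt : Literature.NumberTheory.Automorphic.isCompact_glFiniteIntegralLevel n ℚ, Summit.Langlands.GlobalLanglandsCorrespondenceGLn n ℚ Rec hcpt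

-- item stmt-Langlands-16844 · support · rank 5 · closed · moot by None · by planner — informal only, no Lean statement yet:
--   [crux] INDUCED COMPONENT PROPAGATION (characteristic-0 mechanism behind TorsionLeviInduction; not
--   typable yet: needs char-0 trianguline/ordinary deformation functors at a Q̄_p-point and Emerton's
--   J_P). Let F be a number field, n ≥ 1 with (n even ∨ r₁(F) ≤ 1), p completely split in F, σ : Γ_F →
--   GL_n(Q̄_p) continuous, odd at the real place, trianguline (resp. ordinary) and generic at v | p, and
--   x = Ind_F^Q σ. (i) GALOIS SIDE: the induced locus {Ind_F^Q σ' : σ' a trianguline deformation of σ of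
--   the same tame type} is a union of irreducible components of the global trianguline (resp. ordinary,
--   wei

/-- item stmt-Langlands-16821 · support · rank 9 · closed · moot by None · by planner
sources: KhareThorne2017, HansenUniversalEigenvarieties2017, CalegariMazur2008, BellaicheDimitrov2016
[support] DEFECT SPLITTING (numerology of the line, provable now; proved in the planner's
Sketch.lean by omega): for n ≥ 1 and r₁ + r₂ ≥ 1, l₀(GL_(n(r₁+2r₂))/ℚ) = l₀(Res_(F/ℚ)GL_n) + (r₁ +
r₂ − 1) holds iff n is even or r₁ ≤ 1, with l₀ = the barrier file's `defectGL` (Khare–Thorne (6.2)).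
Reading: dim of the induced locus (Hansen–Newton count over F) = expected dimension over ℚ exactly
then. [difficulty: provable-now] -/
@[route_item "route-Langlands-SplitPrimeInduction"]
def DefectSplitting : Prop :=
  ∀ n r₁ r₂ : ℕ, 0 < n → 0 < r₁ + r₂ → (Literature.Barriers.Langlands.defectGL 1 0 (n * (r₁ + 2 * r₂)) = Literature.Barriers.Langlands.defectGL r₁ r₂ n + (r₁ + r₂ - 1) ↔ (Even n ∨ r₁ ≤ 1))

-- earlier DeinductionR (stmt-Langlands-17127, replaced 2026-08-17T01:28:08Z -> stmt-Langlands-17157): retired by None — ∀ (F : Type) [Field F] [NumberField F] (d : ℕ) (hd : Module.finrank ℚ F = d) (n : ℕ), 1 ≤ n → ∀ (k : Type) [Field k] [IsAlgClosed k] [TopologicalSpace k] [DiscreteTopology k] (S : Finset (IsDedekindDomain.HeightOneSpectrum (NumberField.RingOfIntegers F))) (P : IsDedekindDomain.Heig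
/-- item stmt-Langlands-17157 · support · rank 9 · closed · moot by None · by planner
[support] GALOIS DE-INDUCTION along a non-normal extension, UNIFORM EXCEPTIONAL SET (rev-9
restatement of the rev-7 repair DeinductionR = stmt-Langlands-17127; supersedes the
refuted-misstated Deinduction = stmt-Langlands-16822). F of degree d, n ≥ 1, k algebraically closed
with the discrete topology (so every continuous representation has finite image), S finite, monic
degree-n polynomials P_w (w places of F), and a finite set T of rational places. IF for EVERY
continuous character χ : Γ_F → k^× (Frobenius values c_w off a finite S_χ) there is a semisimple R_χ
: Γ_ℚ → GL_(dn)(k), unramified with charpoly(R_χ(Frob_v^arith)) = ∏_(w∣v) ((P_w).scaleRoots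
c_w)(X^f(w∣v)) at EVERY v ∉ T above which no place of S ∪ S_χ lies — the Frobenius data of Ind_F^ℚ(σ
⊗ χ), with ONE exceptional set T for all twists — THEN there are a continuous σ : Γ_F → GL_n(k) and
a finite T′ with σ unramified at w and charpoly(σ(Frob_w^arith)) = P_w for every w above every v ∉
T′ whose fibre avoids S. WHY THE QUANTIFIER MOVED (planner rfix, 2026-08-17): the rev-7 text let T
depend on χ (∀ χ ∃ R T); that form is FALSE for n ≥ 2, d ≥ 2 by a sparse adversary — F = ℚ(i), σ an
A₅-type Artin representation of Γ_F with -/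
@[route_item "route-Langlands-SplitPrimeInduction", crux]
def DeinductionR : Prop :=
  ∀ (F : Type) [Field F] [NumberField F] (d : ℕ) (hd : Module.finrank ℚ F = d) (n : ℕ), 1 ≤ n → ∀ (k : Type) [Field k] [IsAlgClosed k] [TopologicalSpace k] [DiscreteTopology k] (S : Finset (IsDedekindDomain.HeightOneSpectrum (NumberField.RingOfIntegers F))) (P : IsDedekindDomain.HeightOneSpectrum (NumberField.RingOfIntegers F) → Polynomial k), (∀ w, (P w).Monic ∧ (P w).natDegree = n) → ∀ (T : Finset (IsDedekindDomain.HeightOneSpectrum (NumberField.RingOfIntegers ℚ))), (∀ (χ : Literature.NumberTheory.GaloisRepresentations.FramedGaloisRep F k 1) (c : IsDedekindDomain.HeightOneSpectrum (NumberField.RingOfIntegers F) → k) (Sχ : Finset (IsDedekindDomain.HeightOneSpectrum (NumberField.RingOfIntegers F))), (∀ w ∉ Sχ, χ.IsUnramifiedAt w ∧ χ.HasFrobCharpolyAt w (Polynomial.X - Polynomial.C (c w))) → ∃ R : Literature.NumberTheory.GaloisRepresentations.FramedGaloisRep ℚ k (d * n), R.toGaloisRep.IsSemisimple ∧ ∀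 v ∉ T, (∀ w : IsDedekindDomain.HeightOneSpectrum (NumberField.RingOfIntegers F), w.asIdeal.under (NumberField.RingOfIntegers ℚ) = v.asIdeal → w ∉ S ∧ w ∉ Sχ) → R.IsUnramifiedAt v ∧ R.HasFrobCharpolyAt v (∏ᶠ w ∈ {w : IsDedekindDomain.HeightOneSpectrum (NumberField.RingOfIntegers F) | w.asIdeal.under (NumberField.RingOfIntegers ℚ) = v.asIdeal}, ((P w).scaleRoots (c w)).comp (Polynomial.X ^ w.asIdeal.inertiaDeg (NumberField.RingOfIntegers ℚ)))) → ∃ (σ : Literature.NumberTheory.GaloisRepresentations.FramedGaloisRep F k n) (T' : Finset (IsDedekindDomain.HeightOneSpectrum (NumberField.RingOfIntegers ℚ))), ∀ v ∉ T', (∀ w : IsDedekindDomain.HeightOneSpectrum (NumberField.RingOfIntegers F), w.asIdeal.under (NumberField.RingOfIntegers ℚ) = v.asIdeal → w ∉ S) → ∀ w : IsDedekindDomain.HeightOneSpectrum (NumberField.RingOfIntegers F), w.asIdeal.under (NumberField.RingOfIntegers ℚ) = v.asIdeal → σ.IsUnramifiedAt w ∧ σ.HasFrobCharpolyAt w (P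 w)

-- earlier Assembly (stmt-Langlands-16824, replaced 2026-08-17T01:08:21Z -> stmt-Langlands-17071): retired by None — LanglandsOverQ → TorsionLeviInduction → MonomialSerreAtSplitPrimes → Deinduction → SectorChain → _root_.Langlands
-- earlier Assembly (stmt-Langlands-17071, replaced 2026-08-17T01:15:25Z -> stmt-Langlands-17128): retired by None — TorsionLeviInduction → MonomialSerreAtSplitPrimes → LanglandsOverQ → Deinduction → _root_.Langlands
/-- item stmt-Langlands-17128 · assembly · rank 1 · closed · moot by None · by planner
sources: BuzzardGeeLMS2014, Scholze2015
[assembly] THE JUNCTION (honest out-of-scope remainder, summit-strength, never staffed from this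
route; same convention as E8QuinticResidue.SectorComplement / TwistAveragedDeinduction.AJunction):
TorsionLeviInduction → MonomialSerreAtSplitPrimes → LanglandsOverQ → DeinductionR → Langlands
(hypotheses in rank order: cruxes #2, #3, #4, then the repaired support DeinductionR — the gate
shares items by statement, so the junction could not be re-filed in SectorChain's old hypothesis
order while SectorChain was being dropped); the deciding theorem `closes` is this implication
applied (hA h₂ h₃ h₁ h₄). Rev 6/7 (ground route-repair, then repair of the refuted-misstated
Deinduction → DeinductionR): this is the former support item SectorChain (stmt-Langlands-16823)
carried by the assembly item — the old Assembly L → T → M → D → SectorChain → Langlands was a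
propositional tautology (ground.trivial by tauto) and an assembly item cannot be dropped, so the
junction moved here and SectorChain was dropped as its duplicate. Informal content it hides, in
order of use: Scholze's determinants over ℚ (named fact Scholze2015_galoisRep_of_modPEigensystem at
F = ℚ) applied to the induced eigensystems of a -/
@[route_item "route-Langlands-SplitPrimeInduction", crux]
def Assembly : Prop :=
  TorsionLeviInduction → MonomialSerreAtSplitPrimes → LanglandsOverQ → DeinductionR → _root_.Langlands

-- records of items no longer active in this route (dropped / restated):
-- earlier Deinduction (stmt-Langlands-16822, dropped 2026-08-17T01:16:51Z): refuted by Summit.Langlands.Langlands.Theorems.SplitPrimeInductionDeinduction_refuted @ ecea6ceb0746 — ∀ (F : Type) [Field F] [NumberField F] (d : ℕ) (hd : Module.finrank ℚ F = d) (n : ℕ), 1 ≤ n → ∀ (k : Type) [Field k] [IsAlgClosed k] [TopologicalSpace k] [DiscreteTopology k] (S : Finset (IsDedekindDomain.HeightOneSpectrum 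

/-! D-0027 §2.1 — DECIDING THEOREM (planner-authored via `route open/edit --closes-file`; by planner-rground-Langlands-SplitPrimeInduction-b056c6f0-0 2026-08-17T01:15:25Z) — ARCHIVED: route closed (refuted) 2026-08-20T07:33:32Z; kept so importers keep building:
its hypotheses are this route's items and its conclusion the sub-problem Statement (glue_lint), and it elaborates with this file. -/

@[closes "route-Langlands-SplitPrimeInduction"] theorem closes (h₁ : LanglandsOverQ) (h₂ : TorsionLeviInduction) (h₃ : MonomialSerreAtSplitPrimes)
    (h₄ : DeinductionR) (hA : Assembly) : _root_.Langlands :=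
  hA h₂ h₃ h₁ h₄

end Summit.Langlands.Langlands.Theses.SplitPrimeInduction
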